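import Summits.QuantumFields.YangMills.Theorems.UnitScaleTiltProp7NestedMeanParallelLiftGauge
import Literature.MathematicalPhysics.QuantumFieldTheory.Balaban1983to89.T3SectASteps
import HarnessLib

/-!
# Route `UnitScaleTilt`, crux K1 child «MinimiserStabilityRegPr» (stmt-QuantumFields-19200), stub `stub_existenceMinimalOrbit` (EX), line «SYM-CENTRE»
# (★★OWNER RULING g28-№7 cure (ii-a); px20 g2 LOCATE #56 §6 row (R2)) — **THE SYMMETRIC REGULAR CENTRE OVER THE CENTRAL STRATUM: for a
# coarse field with CENTRAL bond values and small plaquettes, the ITERATED FACE SECTION `secTo V` (the block-constant lift of the tree) lies in the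
# fibre of `V` EXACTLY, is printed-regular at EVERY radius, and satisfies the lifting residue `hLift` — all gauge copies included**

Cell `ym3-torus`, width seat `ym3-torus-px6` (gen 3; px20 g2 «px6: R2-Z2 GO» 22:05:24Z).  THEOREMS ONLY (0 `def`, 0 `sorry`).
`--supports stmt-QuantumFields-19200 --as helper`, count-neutral.  YM₃ on T³ is a ladder rung (R3), not the Clay problem; nothing here claims the stub,
the crux, d = 4 or the mass gap.

THE POINT.  The displayed row `hSymCentre` of the re-centred EX knit S7′ (★w2-19200 g6 21:56:24Z ∕ ★px14 T1′) asks, for every small-field coarse `V`,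
for a fibre point `U₀*` with `RegPr` and `hLift U₀*`.  By the `SU(2)` commutant trichotomy (px20 LOCATE #56) the suppliers are: `p = 0` the stub's own
`U₀` (✓`hLift_of_mem_fibre_of_irreducible`), the pure-gauge layer (✓`hSymCentre_of_pureGauge`), the ABELIAN layer (line SYM-CENTRE (R3)∕(R4)), and the
CENTRAL layer treated here: `V = w • S` with `S` CENTRAL-VALUED (every `S(c)` commutes with `M₂(ℂ)`; the tree-gauge representative of a coarse field all of
whose holonomies are central — e.g. flat fields with a `{±1}` cycle holonomy, which are NOT pure gauges).  For such `S` the tree's threshold-free section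
`secTo S` ([Balaban1987RG1] (0.11); ✓`T3SectASteps.descendTo_secTo`) does everything: it is IN the fibre (exactly), its plaquettes are those of `S` — which are
`1` as soon as they are `2`-small, since a central element of `SU(2)` is `±1` (§2) — so it is printed-regular at every radius (✓`secTo_mem_regFibrePr_of` with
a vanishing plaquette threshold), and its bond values are values of `S` or `1`, hence central, so parallel sections for it and for its average `S` are
exactly the constants: `hLift` holds (§3).  ✓`symCentre_gaugeAct` transports the four conjuncts to every gauge copy `w • S` (§4).
* §1 `iterSec_forall` ∕ `secTo_forall` — a predicate true at `1` and on all values of `V` holds on all values of the section.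
* §2 `coe_eq_one_or_neg_one_of_central` (a central element of `SU(2)` is `±1`), `norm_neg_one_sub_one` (`‖(−1) − 1‖ = 2`), ★`plaqHol_eq_one_of_central`
  (central values + `PlaqSmall δ`, `δ ≤ 2` ⇒ flat), `plaqSmall_of_central` (⇒ `PlaqSmall δ′` for every `δ′ > 0`).
* §3 ★★`secTo_mem_regFibrePr_of_central` (every radius `a > 0`), ★★`hLift_secTo_of_central`.
* §4 ★★★`hSymCentre_of_central` (the four conjuncts at `U₀* := secTo S`, radii `a, b > 0` arbitrary), ★★★`exists_symCentre_of_central_gauge` (for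
  `V = w • S`: centre `(liftTransfTo w) • secTo S`).
HONEST SCOPE.  Bookkeeping over the tree's section; no estimate.  NOT here: the normal form «all holonomies of `V` central ⇒ `V = w • S` with `S`
central-valued» (tree gauge on the discrete torus) — the consumer's case split supplies `w, S`; the abelian layer (R3)∕(R4).  No stub ∕ crux statement
is advanced.

References: T. Bałaban, CMP 109 (1987) 249–301 [Balaban1987RG1] ((0.4), (0.11) p.253); CMP 102 (1985) 277–309 [Balaban1985Variational] ((2)–(7) p.278,
(11)–(14) pp.279–280); CMP 98 (1985) 17–51 [Balaban1985Averaging] ((8)–(11) p.19); CMP 99 (1985) 389–434 [Balaban1985BackgroundPropagators] ((3.21) p.394).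
-/

set_option autoImplicit false

noncomputable section

open scoped BigOperators Matrix.Norms.L2Operator

namespace Summit.QuantumFields.YangMills.Theorems.Prop7SymCentreCentral

open Literature.MathematicalPhysics.QuantumFieldTheory.Balaban1983to89
open T4Continuum BlockAveraging
open B10Eq27TorusAxialLog (gaugeActT unitsField toUField val_unitsField val_suIncl)
open B15DeterminingSets (embIter)
open Summit.QuantumFields.YangMills.Theorems.Prop8Chart (emlIterU)
open Summit.QuantumFields.YangMills.BalabanUVNodes.N12FlatFibreNullSpace (const_of_shift_eq)
open B5Positivity172Lattice (TT ofT)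
open Literature.MathematicalPhysics.QuantumFieldTheory.Balaban1983to89.T3ContinuumYM3Torus
open T3UnitLawDensityEML (ℰp)
open T3TiltDescent (descendTo)
open T3ConstrainedMinimiser (fibre)
open T3DescentFibreTower (expMeanLogSU_E_one)
open T3RegularMinimiser (regThreshold regThreshold_pos)
open T3PrintedRegularMinimiser (RegPr regFibrePr mem_regFibrePr_iff)
open T3PrintedMinimiserExistence (plaqSmall_of_le)
open T3PrintedRegularOrbits (descTransf liftTransfTo descTransf_liftTransfTo)
open T3SectALandauChart (bgUnits CloseAvg closeAvg_of_mem_fibre)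
open T3SectASteps (secTo descendTo_secTo secTo_mem_fibre secTo_mem_regFibrePr_of)
open T3LevelShift (siteShift bondShift fieldShift fieldShift_apply bondShift_src bondShift_tgt)
open BlockAveragingSection (faceSec ExitsBlock faceSec_of_exits faceSec_of_not_exits)
open BlockAveragingSectionAction (iterSec)
open Prop7SymAvgGLSmallOfRegPr (descendTo_eq_fieldShift_emlIterU_of_regPr)
open Summit.QuantumFields.YangMills.Theorems.Prop7NestedMeanParallelLift (symCentre_gaugeAct)

/-! ## §1 Values of the section -/

section Values

variable {P : Params} {G : Type*} [GaugeGroup G]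

/-- A predicate holding at `1` and on every value of `W` holds on every value of the face section `faceSec W` (its values are values of `W` or `1`).
[cite: Balaban1987RG1, (0.4) p.253] -/
theorem faceSec_forall {j : ℕ} {p : G → Prop} (h1 : p 1) (W : GaugeField P (j + 1) G) (hW : ∀ c, p (W c)) (b : PBond P j) :
    p (faceSec W b) := by
  by_cases hb : ExitsBlock b
  · rw [faceSec_of_exits W hb]; exact hW _
  · rw [faceSec_of_not_exits W hb]; exact h1

/-- The same for the iterated section `iterSec k`. [cite: Balaban1987RG1, (0.11) p.253] -/
theorem iterSec_forall {p : G → Prop} (h1 : p 1) :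
    ∀ (k : ℕ) (W : GaugeField P k G), (∀ c, p (W c)) → ∀ b, p (iterSec k W b)
  | 0, _, hW, b => hW b
  | k + 1, W, hW, b => iterSec_forall h1 k (faceSec W) (faceSec_forall h1 W hW) b

end Values

section T3

variable (F : T3Family) {n K : ℕ}

/-- The values of `secTo V` are values of `V` or `1`: a predicate true at `1` and on `V`'s values holds on them. [cite: Balaban1987RG1, (0.11) p.253] -/
theorem secTo_forall {G : Type*} [GaugeGroup G] (h : n ≤ K) {p : G → Prop} (h1 : p 1) (V : GaugeField (F.P n) 0 G) (hV : ∀ c, p (V c))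
    (b : PBond (F.P K) 0) : p (secTo F n K h V b) :=
  iterSec_forall h1 (K - n) _ (fun c => by rw [fieldShift_apply]; exact hV _) b

/-! ## §2 Central elements of `SU(2)`; central-valued small-plaquette fields are flat -/

/-- **A CENTRAL ELEMENT OF `SU(2)` IS `±1`**: if `g` commutes with every matrix it is a scalar `c·1` (Mathlib `Matrix.mem_range_scalar_of_commute_single`)
with `c² = det g = 1`. [folklore] -/
theorem coe_eq_one_or_neg_one_of_central (g : Matrix.specialUnitaryGroup (Fin 2) ℂ)
    (hg : ∀ M : Matrix (Fin 2) (Fin 2) ℂ, Commute (g : Matrix (Fin 2) (Fin 2) ℂ) M) :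
    (g : Matrix (Fin 2) (Fin 2) ℂ) = 1 ∨ (g : Matrix (Fin 2) (Fin 2) ℂ) = -1 := by
  obtain ⟨c, hc⟩ := Matrix.mem_range_scalar_of_commute_single (M := (g : Matrix (Fin 2) (Fin 2) ℂ)) fun i j _ => (hg _).symm
  have hdet : (g : Matrix (Fin 2) (Fin 2) ℂ).det = 1 := (Matrix.mem_specialUnitaryGroup_iff.1 g.2).2
  rw [← hc, Matrix.scalar_apply, Matrix.det_diagonal, Finset.prod_const, Finset.card_univ, Fintype.card_fin] at hdet
  have hc1 : c = 1 ∨ c = -1 := by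
    have : c * c = 1 := by rw [← sq]; exact hdet
    exact mul_self_eq_one_iff.1 this
  rcases hc1 with h | h
  · left; rw [← hc, h, map_one]
  · right; rw [← hc, h, map_neg, map_one]

/-- `‖(−1) − 1‖ = 2` in `M₂(ℂ)` (operator norm). [folklore] -/
theorem norm_neg_one_sub_one : ‖(-1 : Matrix (Fin 2) (Fin 2) ℂ) - 1‖ = 2 := by
  have h : (-1 : Matrix (Fin 2) (Fin 2) ℂ) - 1 = (-2 : ℂ) • (1 : Matrix (Fin 2) (Fin 2) ℂ) := by
    rw [neg_smul, two_smul]; abel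
  rw [h, norm_smul, norm_neg, norm_one, mul_one]
  simp

/-- ★ **CENTRAL VALUES WITH `2`-SMALL PLAQUETTES ARE FLAT**: if every bond value of `S` is central in `M₂(ℂ)` and `PlaqSmall δ S` with `δ ≤ 2`, then
every plaquette variable of `S` is `1` (it is a product of central elements, hence central, hence `±1`, and `dist1 (−1) = 2`). [cite: Balaban1985Variational, (7) p.278] -/
theorem plaqHol_eq_one_of_central {P : Params} {j : ℕ} (S : GaugeField P j (Matrix.specialUnitaryGroup (Fin 2) ℂ))
    (hcen : ∀ (c : PBond P j) (M : Matrix (Fin 2) (Fin 2) ℂ), Commute ((S c : Matrix.specialUnitaryGroup (Fin 2) ℂ) : Matrix (Fin 2) (Fin 2) ℂ) M)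
    {δ : ℝ} (hδ : δ ≤ 2) (hS : PlaqSmall δ S) (p : Plaq P j) : GaugeField.plaqHol S p = 1 := by
  -- the plaquette variable is central
  have hc : ∀ M : Matrix (Fin 2) (Fin 2) ℂ, Commute ((GaugeField.plaqHol S p : Matrix.specialUnitaryGroup (Fin 2) ℂ) : Matrix (Fin 2) (Fin 2) ℂ) M := by
    intro M
    have hinv : ∀ c : PBond P j, Commute (((S c)⁻¹ : Matrix.specialUnitaryGroup (Fin 2) ℂ) : Matrix (Fin 2) (Fin 2) ℂ) M := by
      intro c
      have h1 : (((S c)⁻¹ : Matrix.specialUnitaryGroup (Fin 2) ℂ) : Matrix (Fin 2) (Fin 2) ℂ) = star ((S c : Matrix.specialUnitaryGroup (Fin 2) ℂ) : Matrix (Fin 2) (Fin 2) ℂ) := rfl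
      rw [h1]
      have h2 := commute_star_star.2 (hcen c (star M))
      rwa [star_star] at h2
    simp only [GaugeField.plaqHol, Submonoid.coe_mul]
    exact (((hcen _ M).mul_left (hcen _ M)).mul_left (hinv _)).mul_left (hinv _)
  rcases coe_eq_one_or_neg_one_of_central _ hc with h | h
  · exact Subtype.ext h
  · exfalso
    have hd : ‖((GaugeField.plaqHol S p : Matrix.specialUnitaryGroup (Fin 2) ℂ) : Matrix (Fin 2) (Fin 2) ℂ) - 1‖ < δ := hS p
    rw [h, norm_neg_one_sub_one] at hd
    linarith

/-- Hence such a field has `δ′`-small plaquettes for EVERY `δ′ > 0`. [cite: Balaban1985Variational, (7) p.278] -/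
theorem plaqSmall_of_central {P : Params} {j : ℕ} (S : GaugeField P j (Matrix.specialUnitaryGroup (Fin 2) ℂ))
    (hcen : ∀ (c : PBond P j) (M : Matrix (Fin 2) (Fin 2) ℂ), Commute ((S c : Matrix.specialUnitaryGroup (Fin 2) ℂ) : Matrix (Fin 2) (Fin 2) ℂ) M)
    {δ : ℝ} (hδ : δ ≤ 2) (hS : PlaqSmall δ S) {δ' : ℝ} (hδ' : 0 < δ') : PlaqSmall δ' S := by
  intro p
  rw [plaqHol_eq_one_of_central S hcen hδ hS p, GaugeGroup.dist1_one]
  exact hδ'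

/-! ## §3 The section over a central-valued field: regular at every radius, and `hLift` -/

/-- ★★ **THE SECTION OF A CENTRAL SMALL-PLAQUETTE FIELD IS IN PRINT'S REGULAR FIBRE AT EVERY RADIUS** `a > 0`: its plaquettes are those of `S` (all `1`)
and its divergence is bounded by four vanishing plaquette deviations (✓`secTo_mem_regFibrePr_of` at the plaquette threshold `min(regThreshold a, a·L^{−3(K−n)}∕8)`).
[cite: Balaban1985Variational, (6)-(7) p.278, (11) p.279] -/
theorem secTo_mem_regFibrePr_of_central (h : n ≤ K) (S : GaugeField (F.P n) 0 (Matrix.specialUnitaryGroup (Fin 2) ℂ))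
    (hcen : ∀ (c : PBond (F.P n) 0) (M : Matrix (Fin 2) (Fin 2) ℂ), Commute ((S c : Matrix.specialUnitaryGroup (Fin 2) ℂ) : Matrix (Fin 2) (Fin 2) ℂ) M)
    {δ : ℝ} (hδ : δ ≤ 2) (hS : PlaqSmall δ S) {a : ℝ} (ha : 0 < a) :
    secTo F n K h S ∈ regFibrePr F n K h a S := by
  have hL : (0 : ℝ) < F.L := T3LowerAlongMinimisersSplit.L_cast_pos F
  have hr : 0 < regThreshold F n K a := regThreshold_pos F ha
  have hd : 0 < a * ((F.L : ℝ)⁻¹) ^ (3 * (K - n)) := mul_pos ha (pow_pos (inv_pos.2 hL) _)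
  set ε₁ : ℝ := min (regThreshold F n K a) (a * ((F.L : ℝ)⁻¹) ^ (3 * (K - n)) / 8) with hε₁
  have hε₁pos : 0 < ε₁ := lt_min hr (by positivity)
  have hpl : ε₁ ≤ regThreshold F n K a := min_le_left _ _
  have hdiv : 4 * ε₁ < a * ((F.L : ℝ)⁻¹) ^ (3 * (K - n)) := by
    have h8 : ε₁ ≤ a * ((F.L : ℝ)⁻¹) ^ (3 * (K - n)) / 8 := min_le_right _ _
    linarith
  exact secTo_mem_regFibrePr_of F h hε₁pos hpl hdiv (plaqSmall_of_central S hcen hδ hS hε₁pos)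

/-- ★★ **`hLift` AT THE SECTION OF A CENTRAL-VALUED FIELD**: the iterated average of `secTo S` IS `S` (✓`descendTo_secTo`, read in `(M₂)ˣ` through the
`RegPr` bridge ✓`descendTo_eq_fieldShift_emlIterU_of_regPr` at radius `10⁻⁷L⁻³`), whose central values conjugate trivially, so a parallel coarse section is
shift-invariant hence constant (✓`const_of_shift_eq`); the constant fine section is parallel for `secTo S` because its values are values of `S` or `1` (§1),
all central. [cite: Balaban1985BackgroundPropagators, (3.21) p.394; Balaban1987RG1, (0.11) p.253] -/
theorem hLift_secTo_of_central (h : n ≤ K) (S : GaugeField (F.P n) 0 (Matrix.specialUnitaryGroup (Fin 2) ℂ))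
    (hcen : ∀ (c : PBond (F.P n) 0) (M : Matrix (Fin 2) (Fin 2) ℂ), Commute ((S c : Matrix.specialUnitaryGroup (Fin 2) ℂ) : Matrix (Fin 2) (Fin 2) ℂ) M)
    {δ : ℝ} (hδ : δ ≤ 2) (hS : PlaqSmall δ S) :
    ∀ cf : Site (F.P K) (K - n) → Matrix (Fin 2) (Fin 2) ℂ,
      (∀ e : PBond (F.P K) (K - n), cf e.src = ((emlIterU (K - n) (bgUnits F K (secTo F n K h S)) e : (Matrix (Fin 2) (Fin 2) ℂ)ˣ) : Matrix (Fin 2) (Fin 2) ℂ) * cf e.tgt *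
        (((emlIterU (K - n) (bgUnits F K (secTo F n K h S)) e)⁻¹ : (Matrix (Fin 2) (Fin 2) ℂ)ˣ) : Matrix (Fin 2) (Fin 2) ℂ)) →
      ∃ l₀ : Site (F.P K) 0 → Matrix (Fin 2) (Fin 2) ℂ,
        (∀ b' : PBond (F.P K) 0, l₀ b'.src = ((bgUnits F K (secTo F n K h S) b' : (Matrix (Fin 2) (Fin 2) ℂ)ˣ) : Matrix (Fin 2) (Fin 2) ℂ) * l₀ b'.tgt *
          (((bgUnits F K (secTo F n K h S) b')⁻¹ : (Matrix (Fin 2) (Fin 2) ℂ)ˣ) : Matrix (Fin 2) (Fin 2) ℂ)) ∧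
        ∀ y : Site (F.P K) (K - n), l₀ (embIter (K - n) y) = cf y := by
  -- regularity at the bridge's radius `ε₀ := 10⁻⁷L⁻³`
  have hL : (0 : ℝ) < F.L := T3LowerAlongMinimisersSplit.L_cast_pos F
  set ε₀ : ℝ := (10 ^ 7 * (F.L : ℝ) ^ 3)⁻¹ with hε₀def
  have hε₀ : 0 < ε₀ := by positivity
  have hε : 10 ^ 7 * (F.L : ℝ) ^ 3 * ε₀ ≤ 1 := by
    rw [hε₀def, mul_inv_cancel₀ (by positivity)]
  have hmem := secTo_mem_regFibrePr_of_central F h S hcen hδ hS hε₀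
  have hfib : secTo F n K h S ∈ fibre F ℰp n K h S := ((mem_regFibrePr_iff F).1 hmem).1
  have hreg : RegPr F n K ε₀ (secTo F n K h S) := ((mem_regFibrePr_iff F).1 hmem).2
  -- the iterated average read through the level identification is `S♭`
  have hV : (descendTo F ℰp n K h (secTo F n K h S) : GaugeField (F.P n) 0 (Matrix.specialUnitaryGroup (Fin 2) ℂ)) = S := hfib
  have key := descendTo_eq_fieldShift_emlIterU_of_regPr F h hε₀ hε hreg
  rw [hV] at key
  obtain ⟨hs, key'⟩ : ∃ hs : (F.PP F.m n).sitesPerDir 0 = (F.PP F.m K).sitesPerDir (K - n),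
      unitsField (toUField S) = fieldShift hs (emlIterU (K - n) (bgUnits F K (secTo F n K h S))) := ⟨_, key⟩
  -- the averaged bond variables are the (central) values of `S`
  have havg : ∀ e : PBond (F.P K) (K - n),
      ((emlIterU (K - n) (bgUnits F K (secTo F n K h S)) e : (Matrix (Fin 2) (Fin 2) ℂ)ˣ) : Matrix (Fin 2) (Fin 2) ℂ) =
        ((S ((bondShift hs).symm e) : Matrix.specialUnitaryGroup (Fin 2) ℂ) : Matrix (Fin 2) (Fin 2) ℂ) := by
    intro e
    have h1 := congrFun key' ((bondShift hs).symm e)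
    rw [fieldShift_apply, Equiv.apply_symm_apply] at h1
    have h2 := congrArg Units.val h1
    exact h2.symm
  intro cf hpar
  -- a parallel coarse section is shift-invariant, hence constant
  have hshift : ∀ (y : Site (F.P K) (K - n)) (μ : Fin (F.P K).d), cf (y.shift μ) = cf y := by
    intro y μ
    have hp := hpar ⟨y, μ⟩
    have hA : Commute ((emlIterU (K - n) (bgUnits F K (secTo F n K h S)) ⟨y, μ⟩ : (Matrix (Fin 2) (Fin 2) ℂ)ˣ) : Matrix (Fin 2) (Fin 2) ℂ)
        (cf (⟨y, μ⟩ : PBond (F.P K) (K - n)).tgt) := by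
      rw [havg]; exact hcen _ _
    have h' : cf (⟨y, μ⟩ : PBond (F.P K) (K - n)).src = cf (⟨y, μ⟩ : PBond (F.P K) (K - n)).tgt := by
      rw [hp, hA.eq, mul_assoc, Units.mul_inv, mul_one]
    exact h'.symm
  -- the constant section is parallel for `secTo S`: its values are central
  have hcenS : ∀ (b' : PBond (F.P K) 0) (M : Matrix (Fin 2) (Fin 2) ℂ),
      Commute ((secTo F n K h S b' : Matrix.specialUnitaryGroup (Fin 2) ℂ) : Matrix (Fin 2) (Fin 2) ℂ) M := fun b' M =>
    secTo_forall F h (p := fun g : Matrix.specialUnitaryGroup (Fin 2) ℂ => Commute (g : Matrix (Fin 2) (Fin 2) ℂ) M)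
      (by simp only [OneMemClass.coe_one]; exact Commute.one_left M) S (fun c => hcen c M) b'
  refine ⟨fun _ => cf (ofT (0 : TT (F.P K) (K - n))), fun b' => ?_, fun y => (const_of_shift_eq cf hshift y).symm⟩
  have hval : ((bgUnits F K (secTo F n K h S) b' : (Matrix (Fin 2) (Fin 2) ℂ)ˣ) : Matrix (Fin 2) (Fin 2) ℂ) =
      ((secTo F n K h S b' : Matrix.specialUnitaryGroup (Fin 2) ℂ) : Matrix (Fin 2) (Fin 2) ℂ) := by
    show ((unitsField (toUField (secTo F n K h S)) b' : (Matrix (Fin 2) (Fin 2) ℂ)ˣ) : Matrix (Fin 2) (Fin 2) ℂ) = _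
    rw [val_unitsField]; rfl
  have hB : Commute ((bgUnits F K (secTo F n K h S) b' : (Matrix (Fin 2) (Fin 2) ℂ)ˣ) : Matrix (Fin 2) (Fin 2) ℂ) (cf (ofT (0 : TT (F.P K) (K - n)))) := by
    rw [hval]; exact hcenS b' _
  show cf (ofT (0 : TT (F.P K) (K - n))) = _ * cf (ofT (0 : TT (F.P K) (K - n))) * _
  rw [hB.eq, mul_assoc, Units.mul_inv, mul_one]

/-! ## §4 `hSymCentre` over the central stratum -/

/-- ★★★ **THE SYMMETRIC REGULAR CENTRE OVER A CENTRAL-VALUED COARSE FIELD.**  For `S` with central bond values and `PlaqSmall δ S`, `δ ≤ 2`, and all radii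
`a, b > 0`: `U₀* := secTo S` satisfies `U₀* ∈ fibre S ∧ RegPr a U₀* ∧ CloseAvg b S U₀* ∧ hLift U₀*` — the four conjuncts of the line's displayed row
`hSymCentre`, with NO window. [cite: Balaban1985Variational, (2)-(7) p.278, (13)-(14) p.280; Balaban1987RG1, (0.11) p.253] -/
theorem hSymCentre_of_central (h : n ≤ K) (S : GaugeField (F.P n) 0 (Matrix.specialUnitaryGroup (Fin 2) ℂ))
    (hcen : ∀ (c : PBond (F.P n) 0) (M : Matrix (Fin 2) (Fin 2) ℂ), Commute ((S c : Matrix.specialUnitaryGroup (Fin 2) ℂ) : Matrix (Fin 2) (Fin 2) ℂ) M)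
    {δ : ℝ} (hδ : δ ≤ 2) (hS : PlaqSmall δ S) {a b : ℝ} (ha : 0 < a) (hb : 0 < b) :
    secTo F n K h S ∈ fibre F ℰp n K h S ∧ RegPr F n K a (secTo F n K h S) ∧ CloseAvg F n K h b S (secTo F n K h S) ∧
      ∀ cf : Site (F.P K) (K - n) → Matrix (Fin 2) (Fin 2) ℂ,
        (∀ e : PBond (F.P K) (K - n), cf e.src = ((emlIterU (K - n) (bgUnits F K (secTo F n K h S)) e : (Matrix (Fin 2) (Fin 2) ℂ)ˣ) : Matrix (Fin 2) (Fin 2) ℂ) * cf e.tgt *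
          (((emlIterU (K - n) (bgUnits F K (secTo F n K h S)) e)⁻¹ : (Matrix (Fin 2) (Fin 2) ℂ)ˣ) : Matrix (Fin 2) (Fin 2) ℂ)) →
        ∃ l₀ : Site (F.P K) 0 → Matrix (Fin 2) (Fin 2) ℂ,
          (∀ b' : PBond (F.P K) 0, l₀ b'.src = ((bgUnits F K (secTo F n K h S) b' : (Matrix (Fin 2) (Fin 2) ℂ)ˣ) : Matrix (Fin 2) (Fin 2) ℂ) * l₀ b'.tgt *
            (((bgUnits F K (secTo F n K h S) b')⁻¹ : (Matrix (Fin 2) (Fin 2) ℂ)ˣ) : Matrix (Fin 2) (Fin 2) ℂ)) ∧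
          ∀ y : Site (F.P K) (K - n), l₀ (embIter (K - n) y) = cf y := by
  have hmem := secTo_mem_regFibrePr_of_central F h S hcen hδ hS ha
  have hfib : secTo F n K h S ∈ fibre F ℰp n K h S := ((mem_regFibrePr_iff F).1 hmem).1
  exact ⟨hfib, ((mem_regFibrePr_iff F).1 hmem).2, closeAvg_of_mem_fibre hb hfib, hLift_secTo_of_central F h S hcen hδ hS⟩

/-- ★★★ **`hSymCentre` OVER THE WHOLE CENTRAL STRATUM** (every gauge copy `V = w • S` of a central-valued small-plaquette field): the centre
`(liftTransfTo w) • secTo S` (✓`symCentre_gaugeAct` with `descTransf (liftTransfTo w) = w`). [cite: Balaban1985Variational, (3)-(6) p.278, (13)-(14) p.280; Balaban1985Averaging, (11)-(13) p.19] -/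
theorem exists_symCentre_of_central_gauge (h : n ≤ K) {V : GaugeField (F.P n) 0 (Matrix.specialUnitaryGroup (Fin 2) ℂ)} {δ : ℝ} (hδ : δ ≤ 2)
    (hV : ∃ (w : GaugeTransf (F.P n) 0 (Matrix.specialUnitaryGroup (Fin 2) ℂ)) (S : GaugeField (F.P n) 0 (Matrix.specialUnitaryGroup (Fin 2) ℂ)),
      (∀ (c : PBond (F.P n) 0) (M : Matrix (Fin 2) (Fin 2) ℂ), Commute ((S c : Matrix.specialUnitaryGroup (Fin 2) ℂ) : Matrix (Fin 2) (Fin 2) ℂ) M) ∧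
      PlaqSmall δ S ∧ V = GaugeField.gaugeAct w S)
    {a b : ℝ} (ha : 0 < a) (hb : 0 < b) :
    ∃ U₀ : GaugeField (F.P K) 0 (Matrix.specialUnitaryGroup (Fin 2) ℂ),
      U₀ ∈ fibre F ℰp n K h V ∧ RegPr F n K a U₀ ∧ CloseAvg F n K h b V U₀ ∧
      ∀ cf : Site (F.P K) (K - n) → Matrix (Fin 2) (Fin 2) ℂ,
        (∀ e : PBond (F.P K) (K - n), cf e.src = ((emlIterU (K - n) (bgUnits F K U₀) e : (Matrix (Fin 2) (Fin 2) ℂ)ˣ) : Matrix (Fin 2) (Fin 2) ℂ) * cf e.tgt *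
          (((emlIterU (K - n) (bgUnits F K U₀) e)⁻¹ : (Matrix (Fin 2) (Fin 2) ℂ)ˣ) : Matrix (Fin 2) (Fin 2) ℂ)) →
        ∃ l₀ : Site (F.P K) 0 → Matrix (Fin 2) (Fin 2) ℂ,
          (∀ b' : PBond (F.P K) 0, l₀ b'.src = ((bgUnits F K U₀ b' : (Matrix (Fin 2) (Fin 2) ℂ)ˣ) : Matrix (Fin 2) (Fin 2) ℂ) * l₀ b'.tgt * (((bgUnits F K U₀ b')⁻¹ : (Matrix (Fin 2) (Fin 2) ℂ)ˣ) : Matrix (Fin 2) (Fin 2) ℂ)) ∧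
          ∀ y : Site (F.P K) (K - n), l₀ (embIter (K - n) y) = cf y := by
  obtain ⟨w, S, hcen, hS, rfl⟩ := hV
  obtain ⟨hfib, hreg, -, hLift⟩ := hSymCentre_of_central F h S hcen hδ hS ha hb
  have h4 := symCentre_gaugeAct F h (liftTransfTo F n K h w) ha.le hb hfib hreg hLift
  rw [descTransf_liftTransfTo] at h4
  exact ⟨_, h4⟩

end T3

end Summit.QuantumFields.YangMills.Theorems.Prop7SymCentreCentral

end
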